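import Summits.QuantumAdvantage.QuantumAdvantage.Theorems.SosSandwichPseudoBoundedAAClassicalCorner
import HarnessLib

/-!
# Crux `PseudoBoundedAA` (stmt-QuantumAdvantage-15237, route SosSandwich) — classical corner, quadratic form (1/2):
# leaf averages of a function along a decision tree and the leaf-martingale bound

First half of the quadratic (leaf-martingale) OSSS law for MIXTURES of decision trees on the classical corner `R_T ⊆ K_T` of the
crux PB-AA (`SosSandwichPseudoBoundedAAClassicalCornerQuadratic.lean`: `16·Var[p]² ≤ D̄ · E_x maxⱼ (p(x) − p(xʲ))²`, the `(2,1)`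
shape with the maximum inside the expectation, complementing the tree's `(2,2)` law `16·Var[p]² ≤ D̄²·maxⱼ Infⱼ[p]` of
`Theorems.SosSandwich.ClassicalCorner`).  Vocabulary of `BooleanCorner.osss_depth_aux`: the tree's `DecisionTree`, run with a
partial assignment `ρ` answering the already-queried coordinates (repeated queries cost nothing).

* `exists_leafAvg` — for a tree `t`, a real `g` and any `m` dominating the squared increments of `g` pointwise
  (`(g(x^{j→1}) − g(x^{j→0}))² ≤ m(x)`), there is `A` (the average of `g` over the leaf subcube reached by `x`) with
  `Σ A = Σ g`, `Σ F·g = Σ F·A` for the `0/1` output `F` of `t`, invariance under assigned ignored coordinates, and the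
  **leaf-martingale bound** `Σₓ (A x − ḡ)² ≤ ¼ · depth(t) · Σₓ m x` (the variance of the conditional expectation of `g` on the
  leaves telescopes over the internal nodes into squared AVERAGED increments — Cauchy–Schwarz — and every input meets at most
  `depth` fresh queries).  Stated with `∃ A`, so that no auxiliary definition enters the tree;
* `cov_le_sqrt_depth` — `2^N Σ F g − (Σ F)(Σ g) ≤ (2^N/4)·√(2^N · depth(t) · Σₓ m x)`
  (`Cov(F,g) = E[F·(A − ḡ)] = E[(F − ½)(A − ḡ)] ≤ ½ E|A − ḡ|`, then Cauchy–Schwarz);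
* small auxiliaries: recentring a sum of squares, Cauchy–Schwarz on the cube, weighted Cauchy–Schwarz.

Honest label: helper; no stub, crux or summit is closed.  Sources: R. O'Donnell, M. Saks, O. Schramm, R. Servedio, FOCS 2005,
Thm 3.2; H. K. Lee, ToC 6 (2010) 81–84 (induction with a partial assignment); R. O'Donnell, *Analysis of Boolean Functions*
(CUP 2014) §8.4–§8.6.
-/

set_option linter.dupNamespace false

noncomputable section

namespace Summit.QuantumAdvantage.QuantumAdvantage.Theorems.SosSandwich

open Finset Function
open Literature.Computability.Complexity Literature.Computability.QuantumComplexity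

namespace ClassicalCornerQuadratic

variable {N : ℕ}

/-! ### Small auxiliary facts -/

/-- Shifting the centre of a sum of squares: if `Σₓ A x = 2^N · μ` then
`Σₓ (A x − c)² = Σₓ (A x − μ)² + 2^N (μ − c)²`. [folklore] -/
theorem sum_sq_sub_eq_sum_sq_sub_add (A : (Fin N → Bool) → ℝ) (μ c : ℝ) (hA : ∑ x, A x = (2 : ℝ) ^ N * μ) :
    ∑ x, (A x - c) ^ 2 = (∑ x, (A x - μ) ^ 2) + (2 : ℝ) ^ N * (μ - c) ^ 2 := by
  have h : ∀ x, (A x - c) ^ 2 = (A x - μ) ^ 2 + (2 * (μ - c)) * A x + ((μ - c) ^ 2 - 2 * (μ - c) * μ) := by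
    intro x; ring
  rw [Finset.sum_congr rfl fun x _ => h x, Finset.sum_add_distrib, Finset.sum_add_distrib, ← Finset.mul_sum, hA,
    Finset.sum_const, Finset.card_univ, BooleanCorner.card_cube_nat, nsmul_eq_mul]
  push_cast
  ring

/-- Cauchy–Schwarz on the cube: `(Σₓ d x)² ≤ 2^N · Σₓ (d x)²`. [folklore] -/
theorem sq_sum_le_card_mul_sum_sq (d : (Fin N → Bool) → ℝ) :
    (∑ x, d x) ^ 2 ≤ (2 : ℝ) ^ N * ∑ x, d x ^ 2 := by
  have h := Finset.sum_mul_sq_le_sq_mul_sq (Finset.univ : Finset (Fin N → Bool)) (fun _ => (1 : ℝ)) d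
  simp only [one_mul, one_pow, Finset.sum_const, Finset.card_univ, BooleanCorner.card_cube_nat, nsmul_eq_mul,
    mul_one] at h
  push_cast at h
  exact h

/-- Weighted Cauchy–Schwarz: `Σ_k w_k √a_k ≤ √(Σ_k w_k) · √(Σ_k w_k a_k)` for `w_k, a_k ≥ 0`. [folklore] -/
theorem sum_mul_sqrt_le {ι : Type*} (s : Finset ι) (w a : ι → ℝ) (hw : ∀ k ∈ s, 0 ≤ w k) (ha : ∀ k ∈ s, 0 ≤ a k) :
    ∑ k ∈ s, w k * Real.sqrt (a k) ≤ Real.sqrt (∑ k ∈ s, w k) * Real.sqrt (∑ k ∈ s, w k * a k) := by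
  have hW : 0 ≤ ∑ k ∈ s, w k := Finset.sum_nonneg hw
  rw [← Real.sqrt_mul hW]
  apply Real.le_sqrt_of_sq_le
  have hcs := Finset.sum_mul_sq_le_sq_mul_sq s (fun k => Real.sqrt (w k)) (fun k => Real.sqrt (w k) * Real.sqrt (a k))
  have h1 : ∑ k ∈ s, Real.sqrt (w k) * (Real.sqrt (w k) * Real.sqrt (a k)) = ∑ k ∈ s, w k * Real.sqrt (a k) :=
    Finset.sum_congr rfl fun k hk => by
      rw [← mul_assoc, Real.mul_self_sqrt (hw k hk)]
  have h2 : ∑ k ∈ s, Real.sqrt (w k) ^ 2 = ∑ k ∈ s, w k :=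
    Finset.sum_congr rfl fun k hk => Real.sq_sqrt (hw k hk)
  have h3 : ∑ k ∈ s, (Real.sqrt (w k) * Real.sqrt (a k)) ^ 2 = ∑ k ∈ s, w k * a k :=
    Finset.sum_congr rfl fun k hk => by
      rw [mul_pow, Real.sq_sqrt (hw k hk), Real.sq_sqrt (ha k hk)]
  rw [h1, h2, h3] at hcs
  exact hcs

/-! ### Leaf averages: existence with the leaf-martingale bound (no auxiliary definition) -/

/-- **Leaf averages of a function along a decision tree, with the leaf-martingale bound.**  Let the tree `t` be run on the
input overridden by the partial assignment `ρ` (`x ↦ (k ↦ (ρ k).getD (x k))`), let `g` be any real function on the cube and `m`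
any function with `(g(x^{j→1}) − g(x^{j→0}))² ≤ m(x)` for all `j, x`.  Then there is `A` (the average of `g` over the leaf
subcube reached by `x`) such that: (i) `Σₓ A = Σₓ g`; (ii) `Σₓ F·g = Σₓ F·A` for the `0/1` output `F` of `t`; (iii) `A` ignores
every coordinate that `ρ` assigns and `g` ignores; (iv) `Σₓ (A x − ḡ)² ≤ ¼ · depth(t) · Σₓ m x`, `ḡ = 2^{-N} Σ g`.
Induction on `t` (at a fresh root `i`: `A` branches on `x i` into the leaf averages of the two `i`-sections of `g`; the variance
of `A` splits into the two section variances — induction with `m(x^{i→b})`, whose two sums add up to `2 Σ m` — plus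
`2^N (ḡ₁ − ḡ₀)²/4 ≤ ¼ Σₓ (g(x^{i→1}) − g(x^{i→0}))² ≤ ¼ Σ m` by Cauchy–Schwarz).
[cite: OdonnellEtAl2005, Thm 3.2 (L¹ form)] [cite: Lee2010, Thm 1 (inductive proof)] -/
theorem exists_leafAvg (t : DecisionTree N) :
    ∀ (ρ : Fin N → Option Bool) (g m : (Fin N → Bool) → ℝ),
      (∀ (j : Fin N) (x : Fin N → Bool), (g (update x j true) - g (update x j false)) ^ 2 ≤ m x) →
      ∃ A : (Fin N → Bool) → ℝ,
        (∑ x, A x = ∑ x, g x) ∧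
        (∀ F : (Fin N → Bool) → ℝ, (∀ x, F x = if t.eval (fun k => (ρ k).getD (x k)) = true then (1 : ℝ) else 0) →
          ∑ x, F x * g x = ∑ x, F x * A x) ∧
        (∀ i : Fin N, ρ i ≠ none → (∀ y c, g (update y i c) = g y) → ∀ y c, A (update y i c) = A y) ∧
        ∑ x, (A x - (∑ y, g y) / (2 : ℝ) ^ N) ^ 2 ≤ (1 / 4) * (t.depth : ℝ) * ∑ x, m x := by
  induction t with
  | leaf c =>
    intro ρ g m _
    refine ⟨fun _ => (∑ y, g y) / (2 : ℝ) ^ N, ?_, ?_, ?_, ?_⟩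
    · rw [Finset.sum_const, Finset.card_univ, BooleanCorner.card_cube_nat, nsmul_eq_mul]
      push_cast
      field_simp
    · intro F hF
      have hc : ∀ x : Fin N → Bool, F x = (if c = true then (1 : ℝ) else 0) := fun x => by
        rw [hF x]; simp [DecisionTree.eval]
      simp only [hc, ← Finset.mul_sum]
      rw [Finset.sum_const, Finset.card_univ, BooleanCorner.card_cube_nat, nsmul_eq_mul]
      push_cast
      field_simp
    · intro i _ _ y c'; rfl
    · simp
  | query i t₀ t₁ ih₀ ih₁ =>
    intro ρ g m hm
    have h2 : (2 : ℝ) ^ N ≠ 0 := by positivity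
    have h2N : (0 : ℝ) < (2 : ℝ) ^ N := by positivity
    have hm0 : ∀ x, 0 ≤ m x := fun x => le_trans (sq_nonneg _) (hm i x)
    have hsm0 : 0 ≤ ∑ x, m x := Finset.sum_nonneg fun x _ => hm0 x
    have hd : ((DecisionTree.query i t₀ t₁).depth : ℝ) = max (t₀.depth : ℝ) (t₁.depth : ℝ) + 1 := by
      rw [DecisionTree.depth_query]; push_cast; rfl
    rcases hρ : ρ i with _ | b
    · /- fresh query: split along `x i` -/
      set g₀ : (Fin N → Bool) → ℝ := fun x => g (update x i false) with hg₀
      set g₁ : (Fin N → Bool) → ℝ := fun x => g (update x i true) with hg₁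
      set m₀ : (Fin N → Bool) → ℝ := fun x => m (update x i false) with hm₀
      set m₁ : (Fin N → Bool) → ℝ := fun x => m (update x i true) with hm₁
      -- the sections satisfy the domination hypothesis with the corresponding section of `m`
      have hsec : ∀ b : Bool, ∀ (j : Fin N) (x : Fin N → Bool),
          ((fun y => g (update y i b)) (update x j true) - (fun y => g (update y i b)) (update x j false)) ^ 2
            ≤ (fun y => m (update y i b)) x := by
        intro b j x
        simp only
        by_cases hji : j = i
        · subst hji
          rw [update_idem, update_idem, sub_self]
          simpa using hm0 _
        · rw [update_comm hji, update_comm hji]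
          exact hm j _
      obtain ⟨A₀, hA₀s, hA₀F, hA₀u, hA₀v⟩ := ih₀ (update ρ i (some false)) g₀ m₀ (hsec false)
      obtain ⟨A₁, hA₁s, hA₁F, hA₁u, hA₁v⟩ := ih₁ (update ρ i (some true)) g₁ m₁ (hsec true)
      have hg₀u : ∀ x c, g₀ (update x i c) = g₀ x := fun x c => by simp [hg₀]
      have hg₁u : ∀ x c, g₁ (update x i c) = g₁ x := fun x c => by simp [hg₁]
      have hA₀i : ∀ x c, A₀ (update x i c) = A₀ x := hA₀u i (by simp) hg₀u
      have hA₁i : ∀ x c, A₁ (update x i c) = A₁ x := hA₁u i (by simp) hg₁u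
      refine ⟨fun x => if x i = true then A₁ x else A₀ x, ?_, ?_, ?_, ?_⟩
      · -- (i) the total
        rw [BooleanCorner.sum_ite_update i _ _ hA₁i hA₀i, hA₁s, hA₀s, ← BooleanCorner.sum_eq_half_sum_update i g]
      · -- (ii) `F` cannot tell `g` from `A`
        intro F hF
        set F₀ : (Fin N → Bool) → ℝ :=
          fun x => if t₀.eval (fun k => ((update ρ i (some false)) k).getD (x k)) = true then (1 : ℝ) else 0 with hF₀
        set F₁ : (Fin N → Bool) → ℝ :=
          fun x => if t₁.eval (fun k => ((update ρ i (some true)) k).getD (x k)) = true then (1 : ℝ) else 0 with hF₁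
        have hov : ∀ (b c : Bool) (x : Fin N → Bool),
            (fun k => ((update ρ i (some b)) k).getD ((update x i c) k))
              = fun k => ((update ρ i (some b)) k).getD (x k) := by
          intro b c x; funext k
          by_cases hk : k = i
          · subst hk; simp
          · simp [hk]
        have hF₀u : ∀ x c, F₀ (update x i c) = F₀ x := fun x c => by simp only [hF₀, hov]
        have hF₁u : ∀ x c, F₁ (update x i c) = F₁ x := fun x c => by simp only [hF₁, hov]
        have hovb : ∀ (x : Fin N → Bool),
            (fun k => (ρ k).getD (x k)) = fun k => ((update ρ i (some (x i))) k).getD (x k) := by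
          intro x; funext k
          by_cases hk : k = i
          · subst hk; simp [hρ]
          · simp [hk]
        have hxi : ∀ x : Fin N → Bool, (ρ i).getD (x i) = x i := fun x => by simp [hρ]
        have hFx : ∀ x : Fin N → Bool, F x = if x i = true then F₁ x else F₀ x := by
          intro x
          rw [hF x, DecisionTree.eval_query]
          simp only [hxi x]
          rcases Bool.eq_false_or_eq_true (x i) with hx | hx
          · rw [if_pos hx, if_pos hx, hF₁]
            simp only
            rw [hovb x, hx]
          · have hx' : ¬ (x i = true) := by rw [hx]; decide
            rw [if_neg hx', if_neg hx', hF₀]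
            simp only
            rw [hovb x, hx]
        have hgs : ∀ x : Fin N → Bool, g x = if x i = true then g₁ x else g₀ x := by
          intro x
          rcases Bool.eq_false_or_eq_true (x i) with hx | hx
          · rw [if_pos hx, hg₁]; simp only; rw [← hx, update_eq_self]
          · have hx' : ¬ (x i = true) := by rw [hx]; decide
            rw [if_neg hx', hg₀]; simp only; rw [← hx, update_eq_self]
        have hSfg : ∑ x, F x * g x = ((∑ x, F₁ x * g₁ x) + ∑ x, F₀ x * g₀ x) / 2 := by
          have : ∀ x, F x * g x = if x i = true then F₁ x * g₁ x else F₀ x * g₀ x := by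
            intro x; rw [hFx x, hgs x]; split_ifs <;> rfl
          rw [Finset.sum_congr rfl fun x _ => this x]
          exact BooleanCorner.sum_ite_update i _ _ (fun x c => by rw [hF₁u, hg₁u]) (fun x c => by rw [hF₀u, hg₀u])
        have hSfA : ∑ x, F x * (if x i = true then A₁ x else A₀ x) = ((∑ x, F₁ x * A₁ x) + ∑ x, F₀ x * A₀ x) / 2 := by
          have : ∀ x, F x * (if x i = true then A₁ x else A₀ x) = if x i = true then F₁ x * A₁ x else F₀ x * A₀ x := by
            intro x; rw [hFx x]; split_ifs <;> rfl
          rw [Finset.sum_congr rfl fun x _ => this x]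
          exact BooleanCorner.sum_ite_update i _ _ (fun x c => by rw [hF₁u, hA₁i]) (fun x c => by rw [hF₀u, hA₀i])
        rw [hSfg, hSfA, hA₁F F₁ (fun x => rfl), hA₀F F₀ (fun x => rfl)]
      · -- (iii) invariance under an assigned coordinate `i' ≠ i`
        intro i' hρi' hgi' y c
        have hii : i ≠ i' := by rintro rfl; exact hρi' hρ
        have hy : (update y i' c) i = y i := update_of_ne hii _ _
        have hρ' : ∀ b : Bool, (update ρ i (some b)) i' ≠ none := by
          intro b; rw [update_of_ne (Ne.symm hii)]; exact hρi'
        have hg' : ∀ b : Bool, ∀ y c', (fun y => g (update y i b)) (update y i' c') = (fun y => g (update y i b)) y := by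
          intro b y c'; simp only; rw [update_comm (Ne.symm hii), hgi']
        simp only [hy]
        split_ifs
        · exact hA₁u i' (hρ' true) (hg' true) y c
        · exact hA₀u i' (hρ' false) (hg' false) y c
      · -- (iv) the leaf-martingale bound
        set μ₀ := (∑ y, g₀ y) / (2 : ℝ) ^ N with hμ₀
        set μ₁ := (∑ y, g₁ y) / (2 : ℝ) ^ N with hμ₁
        set gbar := (∑ y, g y) / (2 : ℝ) ^ N with hgbar
        have hgsplit : ∑ y, g y = ((∑ y, g₁ y) + ∑ y, g₀ y) / 2 := BooleanCorner.sum_eq_half_sum_update i g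
        have hgbar' : gbar = (μ₁ + μ₀) / 2 := by
          rw [hgbar, hμ₁, hμ₀, hgsplit]; field_simp
        have hL : ∑ x, ((if x i = true then A₁ x else A₀ x) - gbar) ^ 2
            = ((∑ x, (A₁ x - gbar) ^ 2) + ∑ x, (A₀ x - gbar) ^ 2) / 2 := by
          have : ∀ x : Fin N → Bool, ((if x i = true then A₁ x else A₀ x) - gbar) ^ 2
              = if x i = true then (A₁ x - gbar) ^ 2 else (A₀ x - gbar) ^ 2 := by
            intro x; split_ifs <;> rfl
          rw [Finset.sum_congr rfl fun x _ => this x]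
          exact BooleanCorner.sum_ite_update i _ _ (fun x c => by rw [hA₁i]) (fun x c => by rw [hA₀i])
        have hsA₁ : ∑ x, A₁ x = (2 : ℝ) ^ N * μ₁ := by rw [hA₁s, hμ₁]; field_simp
        have hsA₀ : ∑ x, A₀ x = (2 : ℝ) ^ N * μ₀ := by rw [hA₀s, hμ₀]; field_simp
        have hc₁ := sum_sq_sub_eq_sum_sq_sub_add A₁ μ₁ gbar hsA₁
        have hc₀ := sum_sq_sub_eq_sum_sq_sub_add A₀ μ₀ gbar hsA₀
        -- the two section sums of `m` add up to `2 Σ m`, and the root increment is dominated by `m`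
        have hmsplit : ∑ x, m x = ((∑ x, m₁ x) + ∑ x, m₀ x) / 2 := BooleanCorner.sum_eq_half_sum_update i m
        have hm₁0 : 0 ≤ ∑ x, m₁ x := Finset.sum_nonneg fun x _ => hm0 _
        have hm₀0 : 0 ≤ ∑ x, m₀ x := Finset.sum_nonneg fun x _ => hm0 _
        have hroot : (2 : ℝ) ^ N * (μ₁ - μ₀) ^ 2 ≤ ∑ x, m x := by
          have hdiff : μ₁ - μ₀ = (∑ x, (g₁ x - g₀ x)) / (2 : ℝ) ^ N := by
            rw [hμ₁, hμ₀, Finset.sum_sub_distrib]; field_simp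
          have hcs := sq_sum_le_card_mul_sum_sq (fun x => g₁ x - g₀ x)
          have hdm : ∑ x, (g₁ x - g₀ x) ^ 2 ≤ ∑ x, m x := Finset.sum_le_sum fun x _ => hm i x
          rw [hdiff, div_pow]
          calc (2 : ℝ) ^ N * ((∑ x, (g₁ x - g₀ x)) ^ 2 / ((2 : ℝ) ^ N) ^ 2)
              = (∑ x, (g₁ x - g₀ x)) ^ 2 / (2 : ℝ) ^ N := by field_simp
            _ ≤ ((2 : ℝ) ^ N * ∑ x, (g₁ x - g₀ x) ^ 2) / (2 : ℝ) ^ N := div_le_div_of_nonneg_right hcs h2N.le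
            _ = ∑ x, (g₁ x - g₀ x) ^ 2 := by field_simp
            _ ≤ ∑ x, m x := hdm
        have hd₀ : (t₀.depth : ℝ) * ∑ x, m₀ x ≤ max (t₀.depth : ℝ) (t₁.depth : ℝ) * ∑ x, m₀ x :=
          mul_le_mul_of_nonneg_right (le_max_left _ _) hm₀0
        have hd₁ : (t₁.depth : ℝ) * ∑ x, m₁ x ≤ max (t₀.depth : ℝ) (t₁.depth : ℝ) * ∑ x, m₁ x :=
          mul_le_mul_of_nonneg_right (le_max_right _ _) hm₁0
        rw [hL, hc₁, hc₀, hgbar', hd]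
        have hmid : (μ₁ - (μ₁ + μ₀) / 2) ^ 2 + (μ₀ - (μ₁ + μ₀) / 2) ^ 2 = (μ₁ - μ₀) ^ 2 / 2 := by ring
        nlinarith [hA₁v, hA₀v, hroot, hmid, hd₀, hd₁, hmsplit]
    · /- the root variable is already assigned by `ρ`: the tree behaves as the `b`-subtree -/
      have hxi : ∀ x : Fin N → Bool, (ρ i).getD (x i) = b := fun x => by simp [hρ]
      have hsub : ∀ t : DecisionTree N, (t = t₀ ∨ t = t₁) →
          (∀ x : Fin N → Bool,
            (DecisionTree.query i t₀ t₁).eval (fun k => (ρ k).getD (x k)) = t.eval (fun k => (ρ k).getD (x k))) →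
          (∃ A : (Fin N → Bool) → ℝ, (∑ x, A x = ∑ x, g x) ∧
            (∀ F : (Fin N → Bool) → ℝ, (∀ x, F x = if t.eval (fun k => (ρ k).getD (x k)) = true then (1 : ℝ) else 0) →
              ∑ x, F x * g x = ∑ x, F x * A x) ∧
            (∀ i : Fin N, ρ i ≠ none → (∀ y c, g (update y i c) = g y) → ∀ y c, A (update y i c) = A y) ∧
            ∑ x, (A x - (∑ y, g y) / (2 : ℝ) ^ N) ^ 2 ≤ (1 / 4) * (t.depth : ℝ) * ∑ x, m x) →
          ∃ A : (Fin N → Bool) → ℝ, (∑ x, A x = ∑ x, g x) ∧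
            (∀ F : (Fin N → Bool) → ℝ,
              (∀ x, F x = if (DecisionTree.query i t₀ t₁).eval (fun k => (ρ k).getD (x k)) = true then (1 : ℝ) else 0) →
              ∑ x, F x * g x = ∑ x, F x * A x) ∧
            (∀ i : Fin N, ρ i ≠ none → (∀ y c, g (update y i c) = g y) → ∀ y c, A (update y i c) = A y) ∧
            ∑ x, (A x - (∑ y, g y) / (2 : ℝ) ^ N) ^ 2
              ≤ (1 / 4) * ((DecisionTree.query i t₀ t₁).depth : ℝ) * ∑ x, m x := by
        intro t ht hev hA
        obtain ⟨A, h1, h2, h3, h4⟩ := hA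
        refine ⟨A, h1, fun F hF => h2 F (fun x => by rw [hF x, hev x]), h3, h4.trans ?_⟩
        have hdt : (t.depth : ℝ) ≤ ((DecisionTree.query i t₀ t₁).depth : ℝ) := by
          rw [hd]
          rcases ht with ht | ht <;> rw [ht]
          · linarith [le_max_left (t₀.depth : ℝ) (t₁.depth : ℝ)]
          · linarith [le_max_right (t₀.depth : ℝ) (t₁.depth : ℝ)]
        have := mul_le_mul_of_nonneg_right hdt hsm0
        nlinarith [this]
      cases b with
      | false =>
        exact hsub t₀ (Or.inl rfl) (fun x => by rw [DecisionTree.eval_query]; simp only [hxi x]; rfl)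
          (ih₀ ρ g m hm)
      | true =>
        exact hsub t₁ (Or.inr rfl) (fun x => by rw [DecisionTree.eval_query]; simp only [hxi x]; rfl)
          (ih₁ ρ g m hm)

/-! ### One tree: the covariance against the dominated increments -/

/-- **Quadratic OSSS for one tree.** With `F` the `0/1` output of `t` (run under `ρ`), any real `g` on the cube and any `m`
dominating the squared increments of `g` pointwise:  `2^N Σ F g − (Σ F)(Σ g) ≤ (2^N/4) · √(2^N · depth(t) · Σₓ m x)`, i.e.
`Cov(F, g) ≤ ¼ √(depth · E m)` — from `exists_leafAvg`: `Cov(F,g) = E[F (A − ḡ)] = E[(F − ½)(A − ḡ)] ≤ ½ E|A − ḡ|` and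
Cauchy–Schwarz. [cite: OdonnellEtAl2005, Thm 3.2 (L¹ form)] -/
theorem cov_le_sqrt_depth (t : DecisionTree N) (ρ : Fin N → Option Bool) (F g m : (Fin N → Bool) → ℝ)
    (hF : ∀ x, F x = if t.eval (fun k => (ρ k).getD (x k)) = true then (1 : ℝ) else 0)
    (hm : ∀ (j : Fin N) (x : Fin N → Bool), (g (update x j true) - g (update x j false)) ^ 2 ≤ m x) :
    (2 : ℝ) ^ N * (∑ x, F x * g x) - (∑ x, F x) * (∑ x, g x)
      ≤ (2 : ℝ) ^ N / 4 * Real.sqrt ((2 : ℝ) ^ N * (t.depth : ℝ) * ∑ x, m x) := by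
  obtain ⟨A, hAs, hAF, -, hAv⟩ := exists_leafAvg t ρ g m hm
  have h2 : (2 : ℝ) ^ N ≠ 0 := by positivity
  have h2N : (0 : ℝ) ≤ (2 : ℝ) ^ N := by positivity
  set gbar := (∑ y, g y) / (2 : ℝ) ^ N with hgbar
  have hF12 : ∀ x, |F x - 1 / 2| = 1 / 2 := by
    intro x; rw [hF x]; split_ifs <;> norm_num
  -- `2^N Σ F g − Σ F Σ g = 2^N Σ F (A − ḡ)`
  have hlhs : (2 : ℝ) ^ N * (∑ x, F x * g x) - (∑ x, F x) * (∑ x, g x)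
      = (2 : ℝ) ^ N * ∑ x, F x * (A x - gbar) := by
    have hg : ∑ x, g x = (2 : ℝ) ^ N * gbar := by rw [hgbar]; field_simp
    rw [hAF F hF, hg]
    have : ∑ x, F x * (A x - gbar) = (∑ x, F x * A x) - gbar * ∑ x, F x := by
      rw [Finset.mul_sum, ← Finset.sum_sub_distrib]
      exact Finset.sum_congr rfl fun x _ => by ring
    rw [this]; ring
  -- `Σ (A − ḡ) = 0`, so `Σ F (A − ḡ) = Σ (F − 1/2)(A − ḡ) ≤ (1/2) Σ |A − ḡ|`
  have hzero : ∑ x, (A x - gbar) = 0 := by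
    rw [Finset.sum_sub_distrib, hAs, Finset.sum_const, Finset.card_univ, BooleanCorner.card_cube_nat,
      nsmul_eq_mul, hgbar]
    push_cast
    field_simp
    ring
  set L := ∑ x, |A x - gbar| with hL
  have hkey : ∑ x, F x * (A x - gbar) ≤ (1 / 2) * L := by
    have h1 : ∑ x, F x * (A x - gbar) = ∑ x, (F x - 1 / 2) * (A x - gbar) := by
      have : ∑ x, (F x - 1 / 2) * (A x - gbar) = (∑ x, F x * (A x - gbar)) - (1 / 2) * ∑ x, (A x - gbar) := by
        rw [Finset.mul_sum, ← Finset.sum_sub_distrib]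
        exact Finset.sum_congr rfl fun x _ => by ring
      rw [this, hzero]; ring
    rw [h1, hL, Finset.mul_sum]
    refine Finset.sum_le_sum fun x _ => ?_
    calc (F x - 1 / 2) * (A x - gbar) ≤ |(F x - 1 / 2) * (A x - gbar)| := le_abs_self _
      _ = |F x - 1 / 2| * |A x - gbar| := abs_mul _ _
      _ = 1 / 2 * |A x - gbar| := by rw [hF12 x]
  -- Cauchy–Schwarz: `(2L)² ≤ 4 · 2^N Σ (A − ḡ)² ≤ 2^N · depth · Σ m`
  have hL2 : L ^ 2 ≤ (2 : ℝ) ^ N * ∑ x, (A x - gbar) ^ 2 := by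
    have h := sq_sum_le_card_mul_sum_sq (fun x => |A x - gbar|)
    simp only [sq_abs] at h
    exact h
  have h2L : 2 * L ≤ Real.sqrt ((2 : ℝ) ^ N * (t.depth : ℝ) * ∑ x, m x) := by
    apply Real.le_sqrt_of_sq_le
    have : (2 : ℝ) ^ N * ∑ x, (A x - gbar) ^ 2 ≤ (2 : ℝ) ^ N * ((1 / 4) * (t.depth : ℝ) * ∑ x, m x) :=
      mul_le_mul_of_nonneg_left hAv h2N
    nlinarith [hL2, this]
  rw [hlhs]
  calc (2 : ℝ) ^ N * ∑ x, F x * (A x - gbar) ≤ (2 : ℝ) ^ N * ((1 / 2) * L) := mul_le_mul_of_nonneg_left hkey h2N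
    _ = (2 : ℝ) ^ N / 4 * (2 * L) := by ring
    _ ≤ (2 : ℝ) ^ N / 4 * Real.sqrt ((2 : ℝ) ^ N * (t.depth : ℝ) * ∑ x, m x) :=
        mul_le_mul_of_nonneg_left h2L (by positivity)

end ClassicalCornerQuadratic

end Summit.QuantumAdvantage.QuantumAdvantage.Theorems.SosSandwich
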